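import Summits.BirchSwinnertonDyer.BirchSwinnertonDyer.Theorems.AlignedTransportAtTwoMainConjectureOfRankZeroBSDAtTwoHalfDescentLayerIndexGrowthFiniteTwistKernel
import Summits.BirchSwinnertonDyer.BirchSwinnertonDyer.Theorems.ByReductionTypeAtTwoAdditiveSelmerTwistTransport
import Literature.NumberTheory.EllipticCurves.TwoAdicImageQuadraticTwistProofs
import HarnessLib

/-!
# Route `AlignedTransportAtTwo`, crux C2 `MainConjectureOfRankZeroBSDAtTwo` (stmt-BirchSwinnertonDyer-22298):
# THE `μ`-BOUND ON THE CURVE ITSELF — `2^{μ₂(X(E/ℚ_∞))} ∣ #Sel_{2^∞}(E/ℚ) · #ker g_0(E/ℚ) · #ker g_1(E/ℚ(√2))`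
# for EVERY elliptic `E/ℚ` without a rational `2`-torsion abscissa (any reduction type at `2`) and every cyclotomic Pontryagin-dual datum with `X` f.g. torsion:
# the twist-orbit symmetry `E ↔ E^{(2)}` (cell bsd-2adic's `χ₂`-twist of `X`, `μ(E^{(2)}) = μ(E)`) applied to this gen's honest bound for `E^{(2)}`, whose twist is `E` again

HONEST FRAMING (cell `bsd-f1-sign2`, WIDTH-5 attached prover seat `bsd-line-att-p5` gen 59 on line `birth` of the lead `bsd-line-att-p2`;
`--supports` stmt-BirchSwinnertonDyer-22298, closes nothing; BSD is NOT proved by any of this; the crux C2, its verdict «blocked-on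
`Rank1Residual.GreenbergMuConjectureIrreducible`» and every registered stub (P / T / Kμ / LimDoor / MuIneqʳ / PFμ⁺) are untouched). THEOREMS ONLY — no `def`,
no instance, no named fact, no `sorry`. Sequel of this gen's `…GrowthFiniteTwistHonest` (`2^{μ₂} ∣ #Sel_{2^∞}(E^{(2)}/ℚ)·#ker g_0(E^{(2)})·#ker g_1(E)`) and `…TwistKernel`
(`#ker g_m(E^{(2)}) = #ker g_m(E)`, `m ≥ 1`; restriction-compatible coefficient transport), and of cell bsd-2adic's KERNEL `χ₂`-twist transport of the dual Selmer datum
(`AddSelmerTwistTwo.exists_twist_selmerDualData_two_of_isTopGenerator`: for every model `W₂` of `W^{(2)}`, each `D : X(W/ℚ_∞)` has a companion `D₂ : X(W₂/ℚ_∞)` with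
`μ(D₂) = μ(D)`, `λ(D₂) = λ(D)`, torsion ⟺, f.g. ⟺; and `W` is a model of `W₂^{(2)}`).

THE POINT. (§1, any `K`, `p`, `κ`, `m`) ORDERS ARE MODEL-INVARIANT: for `K`-isomorphic curves `V • W₁ = W₂` the coefficient transport `Ψ_V = coeffH1Equiv` (tree, `χ = 1`)
matches the Selmer groups over every `K̄^H` (tree `mem_selmerGroupOver_iff_of_variableChange`) and COMMUTES WITH RESTRICTION (`coeffH1Equiv_resOfLe`), so by `…TwistKernel` §1
**`#Sel_{p^∞}(W₁/K_m) = #Sel_{p^∞}(W₂/K_m)`, `#A_m(W₁) = #A_m(W₂)`, `#ker g_m(W₁) = #ker g_m(W₂)`** for every layer `m`. (§2, `K = ℚ`, `p = 2`, `κ` cyclotomic) Run this gen's honest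
bound for the ELLIPTIC curve `E₂ := E^{(2)}` (no rational `2`-torsion abscissa iff `E` has none, tree `exists_hasRationalTwoTorsionX_quadraticTwist_iff`) and its twist `E₂^{(2)} ≅ E`
(tree `exists_variableChange_smul_eq_quadraticTwist_two_of_model`): `2^{μ(D₂)} ∣ #Sel_{2^∞}(E₂^{(2)}/ℚ)·#ker g_0(E₂^{(2)})·#ker g_1(E₂)`; transport `μ(D₂) = μ(D)` (bsd-2adic), the
level-`0` orders along `E₂^{(2)} ≅ E` (§1) and `#ker g_1(E₂) = #ker g_1(E)` (`…TwistKernel`): ★★★ **`2^{μ(X(E/ℚ_∞))} ∣ #Sel_{2^∞}(E/ℚ) · #ker g_0(E) · #ker g_1(E)`**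
(`pow_mu_dvd_natCard_selmerLayer_zero_mul_kerG_zero_mul_kerG_one`) — Greenberg's `μ`-invariant at `2` bounded by the curve's OWN `2^∞`-Selmer group over `ℚ` and its two lowest
control kernels, with NO twist, NO limit object beyond `ker g`, NO reduction hypothesis at `2`, for EVERY `E/ℚ` with `E[2]` irreducible (⟺ no rational `2`-torsion point). Compare the
classical `μ ≤ ord₂ f_E(0)` with `f_E(0) ∼ #Sel_{2^∞}(E/ℚ) · ∏_v c_v^{(2)} · #Ẽ(𝔽₂)[2]² / #E(ℚ)[2]²` (Greenberg Thm. 4.1 / Perrin-Riou / Schneider — a NAMED FACT in the tree, good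
ORDINARY `2` only): the present bound is KERNEL (std axioms) and reduction-type-free, at the price of the extra factor `#ker g_1(E)` and of Greenberg's global `ker g_0 = A_0/Sel_0` in
place of the local product. Also ★★ both members of the twist pair bound `μ₂`: `2^{μ₂(E)} ∣ #Sel_{2^∞}(E^{(2)}/ℚ)·#ker g_0(E^{(2)})·#ker g_1(E)` (file `…Honest`) — `μ₂(E) = μ₂(E^{(2)})`.
HONEST CAVEATS: `Nat.card` divisibility (empty where a kernel is infinite — for `E` good ordinary at `2` the tree bounds `#ker g_n(E)` uniformly, `exists_forall_natCard_kerG_pos_le_two`;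
nothing is claimed about finiteness otherwise); nothing numerical about any curve; C2 untouched. Memo `Cruxes/MainConjectureOfRankZeroBSDAtTwo/RELAXED-PREIMAGE-att-p5-g59.md`.

References: R. Greenberg, LNM 1716 (1999), §1 Conj. 1.11, §3 pp. 85–90, §4 Thm. 4.1, Lemma 4.3, p. 107 [GreenbergLNM1716]; K. Rubin, *Euler Systems* VI §1–§2 [Rubin2000];
T. & V. Dokchitser, Ann. of Math. 172 (2010) Lemma 4.14 [DokchitserDokchitserAnnals2010]; K. Kramer, Trans. AMS 264 (1981) Thm. 1 [Kramer1981]; J. Silverman, AEC X.2 Prop. 2.4, X.5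
Cor. 5.4 [SilvermanAEC2009]; L. Washington, GTM 83 §13.1, §13.3 Thm. 13.13 [Washington1997].
-/

set_option linter.dupNamespace false
set_option autoImplicit false

noncomputable section

open scoped Classical

universe u

namespace Summit.BirchSwinnertonDyer.BirchSwinnertonDyer.Theorems.AlignedTransportAtTwoHalfDescentLayerIndexGrowthFiniteTwistOrbit

open WeierstrassCurve Literature.NumberTheory.EllipticCurves Literature.NumberTheory.EllipticCurves.CoeffTwist
  Literature.NumberTheory.EllipticCurves.FineSelmerCoefficientMap Literature.NumberTheory.EllipticCurves.Greenberg1999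
  Summit.BirchSwinnertonDyer.BirchSwinnertonDyer.Theorems
  Summit.BirchSwinnertonDyer.BirchSwinnertonDyer.Theorems.AlignedTransportAtTwoHalfDescentLayerIndexGrowthFiniteCell
  Summit.BirchSwinnertonDyer.BirchSwinnertonDyer.Theorems.AlignedTransportAtTwoHalfDescentLayerIndexGrowthFiniteTwistHonest
  Summit.BirchSwinnertonDyer.BirchSwinnertonDyer.Theorems.AlignedTransportAtTwoHalfDescentLayerIndexGrowthFiniteTwistKernel

/-! ## §1 Model invariance: `K`-isomorphic curves have the same `#Sel_m`, `#A_m`, `#ker g_m` (any `K`, `p`, `κ`, `m`) -/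

section Model

variable {K : Type u} [Field K] [NumberField K] {W₁ W₂ : WeierstrassCurve K} {V : VariableChange K} (hV : V • W₁ = W₂) (p : ℕ)

omit [NumberField K] in
/-- ★ **A coefficient transport `Ψ_e = coeffH1Equiv` COMMUTES WITH RESTRICTION** between subgroups `H ≤ H′` on which the sign `χ` is trivial: both composites are the map of `H¹` along the
compatible pair `(H ↪ H′, e)` (tree `resOfLe_comp_resH1Hom_id`). [cite: SerreGaloisCohomology1997, I.§2.4–2.5] [cite: GreenbergLNM1716, §4 p. 107] -/
theorem coeffH1Equiv_resOfLe {W W' : WeierstrassCurve K} (e : geomPoints W' ≃+ geomPoints W) (χ : Field.absoluteGaloisGroup K → ℤ)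
    (he : ∀ (σ : Field.absoluteGaloisGroup K) (P : geomPoints W'), e (σ • P) = χ σ • σ • e P)
    {H H' : Subgroup (Field.absoluteGaloisGroup K)} (hle : H ≤ H') (hχH : ∀ σ : Field.absoluteGaloisGroup K, σ ∈ H → χ σ = 1)
    (hχH' : ∀ σ : Field.absoluteGaloisGroup K, σ ∈ H' → χ σ = 1) (x : W'.subgroupH1 p H') :
    W.resOfLe p hle (coeffH1Equiv p H' e χ he hχH' x) = coeffH1Equiv p H e χ he hχH ((W').resOfLe p hle x) := by
  simp only [coeffH1Equiv_eq_subgroupH1Congr, subgroupH1Congr_apply]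
  exact DFunLike.congr_fun (resOfLe_comp_resH1Hom_id (M := W'.geomPrimaryTorsion p) (M' := W.geomPrimaryTorsion p) hle _ _ _) x

variable {p} [hp : Fact p.Prime] (κ : ZpExtension K p)

include hV in
/-- ★★ **`#Sel_{p^∞}(W₁/K_m) = #Sel_{p^∞}(W₂/K_m)` for `K`-isomorphic curves `V • W₁ = W₂`**, every `ℤ_p`-extension and layer. [cite: SilvermanAEC2009, X.§4] [cite: GreenbergLNM1716, §4 p. 107] -/
theorem natCard_selmerLayer_eq_of_variableChange (m : ℕ) : Nat.card (W₁.selmerLayer κ m) = Nat.card (W₂.selmerLayer κ m) :=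
  (natCard_selmerLayer_eq_natCard_twist W₂ W₁ κ m
    (coeffH1Equiv p (κ.layerSubgroup m) (twistPointsIso hV) (fun _ ↦ 1) (twistPointsIso_smul_one hV) (fun _ _ ↦ rfl))
    (fun x ↦ mem_selmerGroupOver_iff_of_variableChange hV p (κ.layerSubgroup m) x)).symm

include hV in
/-- ★★ **`#A_m(W₁) = #A_m(W₂)` for `K`-isomorphic curves** (Greenberg's preimages `h_m⁻¹(Sel_∞)`). [cite: GreenbergLNM1716, §3 p. 85, §4 p. 107] -/
theorem natCard_selmerInftyPreimage_eq_of_variableChange (m : ℕ) : Nat.card (W₁.selmerInftyPreimage κ m) = Nat.card (W₂.selmerInftyPreimage κ m) :=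
  (natCard_selmerInftyPreimage_eq_natCard_twist W₂ W₁ κ m
    (coeffH1Equiv p (κ.layerSubgroup m) (twistPointsIso hV) (fun _ ↦ 1) (twistPointsIso_smul_one hV) (fun _ _ ↦ rfl))
    (coeffH1Equiv p κ.kerSubgroup (twistPointsIso hV) (fun _ ↦ 1) (twistPointsIso_smul_one hV) (fun _ _ ↦ rfl))
    (fun x ↦ mem_selmerGroupOver_iff_of_variableChange hV p κ.kerSubgroup x)
    (fun x ↦ coeffH1Equiv_resOfLe p (twistPointsIso hV) (fun _ ↦ 1) (twistPointsIso_smul_one hV) (κ.kerSubgroup_le_layerSubgroup m)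
      (fun _ _ ↦ rfl) (fun _ _ ↦ rfl) x)).symm

include hV in
/-- ★★★ **`#ker g_m(W₁) = #ker g_m(W₂)` for `K`-isomorphic curves `V • W₁ = W₂`**: Greenberg's control kernels are invariants of the `K`-isomorphism class (every `ℤ_p`-extension, every layer;
`Nat.card`). [cite: GreenbergLNM1716, §3 pp. 85–90, §4 p. 107] -/
theorem natCard_kerG_eq_of_variableChange (m : ℕ) : Nat.card (W₁.KerG κ m) = Nat.card (W₂.KerG κ m) :=
  (natCard_kerG_eq_natCard_twist_kerG W₂ W₁ κ m
    (coeffH1Equiv p (κ.layerSubgroup m) (twistPointsIso hV) (fun _ ↦ 1) (twistPointsIso_smul_one hV) (fun _ _ ↦ rfl))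
    (coeffH1Equiv p κ.kerSubgroup (twistPointsIso hV) (fun _ ↦ 1) (twistPointsIso_smul_one hV) (fun _ _ ↦ rfl))
    (fun x ↦ mem_selmerGroupOver_iff_of_variableChange hV p (κ.layerSubgroup m) x)
    (fun x ↦ mem_selmerGroupOver_iff_of_variableChange hV p κ.kerSubgroup x)
    (fun x ↦ coeffH1Equiv_resOfLe p (twistPointsIso hV) (fun _ ↦ 1) (twistPointsIso_smul_one hV) (κ.kerSubgroup_le_layerSubgroup m)
      (fun _ _ ↦ rfl) (fun _ _ ↦ rfl) x)).symm

end Model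

/-! ## §2 `K = ℚ`, `p = 2`: the twist orbit `{E, E^{(2)}}` and the `μ`-bound on the curve itself -/

section Rat

variable (W : WeierstrassCurve ℚ) [W.IsElliptic] (κ : ZpExtension ℚ 2) {γ : Field.absoluteGaloisGroup ℚ}

omit [W.IsElliptic] in
/-- `E` has no rational `2`-torsion abscissa ⟹ neither has `E^{(2)}` (the `2`-division abscissae scale by `2`; tree `exists_hasRationalTwoTorsionX_quadraticTwist_iff`). [cite: SilvermanAEC2009, X.2 Prop. 2.4] -/
theorem forall_not_hasRationalTwoTorsionX_quadraticTwist_two (ht : ∀ x : ℚ, ¬ HasRationalTwoTorsionX W x) :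
    ∀ x : ℚ, ¬ HasRationalTwoTorsionX (W.quadraticTwist 2) x := by
  intro x hx
  obtain ⟨y, hy⟩ := (exists_hasRationalTwoTorsionX_quadraticTwist_iff W (two_ne_zero : (2 : ℚ) ≠ 0)).mp ⟨x, hx⟩
  exact ht y hy

/-- ★★★ **THE `μ`-BOUND ON THE CURVE ITSELF.** `E/ℚ` elliptic without a rational `2`-torsion abscissa (i.e. `E[2]` irreducible; ANY reduction type at `2`), `κ` the cyclotomic
`ℤ₂`-extension with topological generator `γ`, `D` ANY Pontryagin-dual datum for `Sel_{2^∞}(E/ℚ_∞)` with `X` finitely generated torsion: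
**`2^{μ(X(E/ℚ_∞))} ∣ #Sel_{2^∞}(E/ℚ) · #ker g_0(E/ℚ) · #ker g_1(E/ℚ(√2))`** (`ker g_m = A_m/Sel_m`, the tree's `KerG κ m`; `Nat.card`). Proof: bsd-2adic's `χ₂`-twist transport
`μ(X(E^{(2)})) = μ(X(E))` + this gen's honest bound for `E^{(2)}` (whose twist by `2` is a `ℚ`-model of `E`) + model invariance (§1) + `#ker g_1(E^{(2)}) = #ker g_1(E)` (`…TwistKernel`).
[cite: GreenbergLNM1716, Conj. 1.11, §3 Lemmas 3.1–3.5, §4 Lemma 4.3, p. 107] [cite: DokchitserDokchitserAnnals2010, Lemma 4.14 (proof)] [cite: Washington1997, §13.1, §13.3 Thm. 13.13] -/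
theorem pow_mu_dvd_natCard_selmerLayer_zero_mul_kerG_zero_mul_kerG_one (hκ : κ.IsCyclotomic) (hγ : κ.IsTopGenerator γ) (ht : ∀ x : ℚ, ¬ HasRationalTwoTorsionX W x)
    (D : W.SelmerDualData κ γ) [hDfin : Module.Finite (IwasawaAlgebra 2) D.X] (hD : D.IsTorsion) :
    2 ^ D.mu ∣ Nat.card (W.selmerLayer κ 0) * Nat.card (W.KerG κ 0) * Nat.card (W.KerG κ 1) := by
  haveI : (W.quadraticTwist 2).IsElliptic := W.isElliptic_quadraticTwist two_ne_zero
  have hV : (1 : VariableChange ℚ) • W.quadraticTwist 2 = W.quadraticTwist 2 := one_smul _ _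
  obtain ⟨D₂, e, -, htors, -, -, hmu, -, hfin⟩ :=
    AddSelmerTwistTwo.exists_twist_selmerDualData_two_of_isTopGenerator κ hκ W (W.quadraticTwist 2) hV hγ D
  haveI : Module.Finite (IwasawaAlgebra 2) D₂.X := hfin.mpr hDfin
  have h := pow_mu_dvd_quadraticTwist_two_selmer_mul_kerG_mul_kerG (W.quadraticTwist 2) κ hκ hγ (forall_not_hasRationalTwoTorsionX_quadraticTwist_two W ht)
    D₂ (htors.mpr hD)
  rw [hmu] at h
  obtain ⟨V', hV'⟩ := AddSelmerTwistTwo.exists_variableChange_smul_eq_quadraticTwist_two_of_model W (W.quadraticTwist 2) hV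
  rw [← natCard_selmerLayer_eq_of_variableChange hV' κ 0, ← natCard_kerG_eq_of_variableChange hV' κ 0,
    (natCard_selmerLayer_and_kerG_quadraticTwist_two_eq W κ hκ hγ le_rfl).2] at h
  exact h

/-- ★★ The door form on the curve itself (weak at the first layer: `2^{2⁰} = 2`): **`Sel_{2^∞}(E/ℚ) = 0`, `ker g_0(E) = 0`, `ker g_1(E) = 0` ⟹ `μ(X(E/ℚ_∞)) = 0`**.
[cite: GreenbergLNM1716, Conj. 1.11, §3, §4 Lemma 4.3] -/
theorem mu_eq_zero_of_natCard_selmerLayer_zero_mul_kerG_zero_mul_kerG_one_lt (hκ : κ.IsCyclotomic) (hγ : κ.IsTopGenerator γ) (ht : ∀ x : ℚ, ¬ HasRationalTwoTorsionX W x)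
    (D : W.SelmerDualData κ γ) [Module.Finite (IwasawaAlgebra 2) D.X] (hD : D.IsTorsion)
    (hpos : 0 < Nat.card (W.selmerLayer κ 0) * Nat.card (W.KerG κ 0) * Nat.card (W.KerG κ 1))
    (hlt : Nat.card (W.selmerLayer κ 0) * Nat.card (W.KerG κ 0) * Nat.card (W.KerG κ 1) < 2) : D.mu = 0 := by
  have h := pow_mu_dvd_natCard_selmerLayer_zero_mul_kerG_zero_mul_kerG_one W κ hκ hγ ht D hD
  have hle := (Nat.le_of_dvd hpos h).trans_lt hlt
  by_contra hμ
  have h2 : 2 ≤ 2 ^ D.mu := by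
    calc (2 : ℕ) = 2 ^ 1 := (pow_one 2).symm
      _ ≤ 2 ^ D.mu := Nat.pow_le_pow_right Nat.two_pos (Nat.one_le_iff_ne_zero.mpr hμ)
  exact absurd (h2.trans_lt hle) (lt_irrefl _)

/-- ★★ **`μ₂` is bounded by EITHER member of the twist pair `{E, E^{(2)}}`**: together with `…Honest`,
`2^{μ(X(E/ℚ_∞))} ∣ gcd(#Sel_{2^∞}(E/ℚ)·#ker g_0(E), #Sel_{2^∞}(E^{(2)}/ℚ)·#ker g_0(E^{(2)})) · #ker g_1(E)` — stated as the pair of divisibilities.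
[cite: GreenbergLNM1716, Conj. 1.11, §3, §4 Lemma 4.3, p. 107] -/
theorem pow_mu_dvd_and_pow_mu_dvd_twist (hκ : κ.IsCyclotomic) (hγ : κ.IsTopGenerator γ) (ht : ∀ x : ℚ, ¬ HasRationalTwoTorsionX W x)
    (D : W.SelmerDualData κ γ) [Module.Finite (IwasawaAlgebra 2) D.X] (hD : D.IsTorsion) :
    2 ^ D.mu ∣ Nat.card (W.selmerLayer κ 0) * Nat.card (W.KerG κ 0) * Nat.card (W.KerG κ 1) ∧
      2 ^ D.mu ∣ Nat.card ((W.quadraticTwist 2).selmerLayer κ 0) * Nat.card ((W.quadraticTwist 2).KerG κ 0) * Nat.card (W.KerG κ 1) :=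
  ⟨pow_mu_dvd_natCard_selmerLayer_zero_mul_kerG_zero_mul_kerG_one W κ hκ hγ ht D hD,
    pow_mu_dvd_quadraticTwist_two_selmer_mul_kerG_mul_kerG W κ hκ hγ ht D hD⟩

end Rat

end Summit.BirchSwinnertonDyer.BirchSwinnertonDyer.Theorems.AlignedTransportAtTwoHalfDescentLayerIndexGrowthFiniteTwistOrbit

end
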